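import Mathlib

/-!
# Route «KPlusLogSqLaw», crux `WeakLifting` (stmt-ValiantsHypothesis-19561) — door (A′), pattern 𝒫 (one death, then a slow rise):
# the TWO-POINT IDENTITY, the WALL MAP and the two EXCLUDED DIRECTIONS (kernel cores, g16)

HONEST FRAMING.  Helper lemmas (`--supports stmt-ValiantsHypothesis-19561 --as helper`), seat pub-symmetroid-conjb-2 (g16), cell `pub-symmetroid`,
2026-08-28.  Elementary algebra in `ℂ` and plane geometry of the half-disc `{|z − ½| ≤ ½, Im z > 0}`; nothing here is an upper bound on any root
count and nothing bears on `WeakLifting` / `TropicalB` (stmt-19771) in their windows, on Conjecture B (`KPlusLogSqLaw`), on `MatrixDescartes` or on VP ≠ VNP.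

CONTEXT (paper: cell deposit HOME/pub-symmetroid-conjb-2/g16/theory/THEORY-NOTE-g16.md §1, §3, §6a; g15 THEORY-NOTE v4 §5c–§5e).  Along the imaginary
axis `x = it` the continuant ratios `r_k = p_k/p_{k−1}` of a definite static tridiagonal design obey the Möbius chain `r_{k+1} = 1 + c_k / r_k`.  For a
«pattern-𝒫» word — a sector-coherent prefix in automaton state Q4 (so `z := 1/r_j(it)` lies in the upper half-disc), then the letter `−1` with
weight `a` (`c = i a/t`), then `+1` with weight `b` (`c = −i b t`) — the last two steps multiply to
  `r_{j+1} r_{j+2} = 1 + i((a/t) z − b t) = (i a/t)(z − π(t))`,  `π(t) = (b t²/a) + i (t/a)`     (`death_rise_product`, `death_rise_eq_twoPoint`),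
so the axis zeros of `Q = p_{j+2}` are exactly the meetings of `z(t)` with the comparison point `π(t)` (the WALL MAP `death_rise_eq_zero_iff`:
`a = t/Im z`, `b = Re z/(t Im z)`), and the winding correction `W` of g15 §5c is minus the lap number of `z − π` (paper Prop. 4).  Theorem 6 of the
note (prefixes `(±2)^k(+1)`: `W ∈ {−1, 0}`, hence (A′) for those words) rests on two excluded directions, typed here as
`twoPoint_not_below_of_mem_arc` (while `π` is inside the open disc, the boundary-arc point on its vertical is strictly ABOVE `π`) and
`twoPoint_not_above_of_not_mem_disc` (once `π` has left the closed disc, no point of the disc is above `π` on its vertical).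
[this seat; elementary]
-/

-- `Summit.ValiantsHypothesis.ValiantsHypothesis.…` repeats a component by the D-0017 layout (single-conjunct summit); the name is mandated.
set_option linter.dupNamespace false

namespace Summit.ValiantsHypothesis.ValiantsHypothesis.Theorems.KPlusLogSqLaw.TwoPoint

open Complex

/-! ## 1. The two-point identity and the wall map -/

/-- ONE DEATH, THEN A SLOW RISE.  With `r₁ = 1 + i(a/t)z` (letter `−1`, weight `a`, `z = 1/r_j(it)`) and `r₂ = 1 − i b t/r₁` (letter `+1`, weight `b`):
`r₁ r₂ = 1 + i((a/t) z − b t)`. -/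
theorem death_rise_product (a b t : ℝ) (z : ℂ) (h : (1 : ℂ) + I * (a / t : ℝ) * z ≠ 0) :
    ((1 : ℂ) + I * (a / t : ℝ) * z) * (1 - I * b * t / ((1 : ℂ) + I * (a / t : ℝ) * z))
      = 1 + I * ((a / t : ℝ) * z - b * t) := by
  rw [mul_sub, mul_one, mul_div_cancel₀ _ h]
  ring

/-- The same product as `(i a/t)·(z − π(t))` with the COMPARISON POINT `π(t) = b t²/a + i t/a` (for `a ≠ 0`, `t ≠ 0`). -/
theorem death_rise_eq_twoPoint (a b t : ℝ) (z : ℂ) (ha : a ≠ 0) (ht : t ≠ 0) :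
    (1 : ℂ) + I * ((a / t : ℝ) * z - b * t)
      = I * (a / t : ℝ) * (z - ((b * t ^ 2 / a : ℝ) + I * (t / a : ℝ))) := by
  have ha' : (a : ℂ) ≠ 0 := by exact_mod_cast ha
  have ht' : (t : ℂ) ≠ 0 := by exact_mod_cast ht
  push_cast
  field_simp
  ring_nf
  simp [pow_two]

/-- One death alone creates no ambiguity: `Im r₁ = (a/t)·Re z`, positive when `a, t > 0` and `Re z > 0` (state Q4), so `r_{j+1}(it)` stays in the
upper half-plane. -/
theorem death_im (a t : ℝ) (z : ℂ) : ((1 : ℂ) + I * (a / t : ℝ) * z).im = a / t * z.re := by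
  simp [Complex.mul_im, Complex.mul_re]

/-- WALL MAP.  For `t > 0`: `1 + i((a/t) z − b t) = 0 ↔ a·Im z = t ∧ a·Re z = b·t²`, i.e. the axis zeros of `Q` at height `t` occur exactly for the
weights `a = t/Im z(t)`, `b = Re z(t)/(t·Im z(t))` (THEORY-NOTE-g16 Lemma 1: in `u = ln(a/b)`, `v = ln(ab)` this is the wall curve
`(2 ln t − ln Re z, ln Re z − 2 ln Im z)`). -/
theorem death_rise_eq_zero_iff (a b t : ℝ) (z : ℂ) (ht : 0 < t) :
    (1 : ℂ) + I * ((a / t : ℝ) * z - b * t) = 0 ↔ a * z.im = t ∧ a * z.re = b * t ^ 2 := by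
  have ht0 : t ≠ 0 := ht.ne'
  rw [Complex.ext_iff]
  simp only [add_re, one_re, mul_re, I_re, I_im, sub_re, sub_im, ofReal_re, ofReal_im, mul_im, zero_mul, zero_sub,
    add_im, one_im, zero_add, one_mul, zero_re, zero_im, sub_zero, mul_zero, add_zero]
  constructor
  · rintro ⟨h1, h2⟩
    constructor
    · have : a / t * z.im = 1 := by linarith
      field_simp at this
      linarith
    · have : a / t * z.re - b * t = 0 := by linarith
      field_simp at this
      nlinarith [this]
  · rintro ⟨h1, h2⟩
    constructor
    · have : a / t * z.im = 1 := by
        field_simp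
        linarith
      linarith
    · have : a / t * z.re = b * t := by
        field_simp
        nlinarith [h2]
      linarith

/-! ## 2. The half-disc and the two excluded directions (Theorem 6 of the note) -/

/-- State Q4 in the `z = 1/r` chart: for `z ≠ 0`, `Re (1/z) ≥ 1 ↔ |z|² ≤ Re z` (the closed disc `|z − ½| ≤ ½`). -/
theorem one_le_inv_re_iff (z : ℂ) (hz : z ≠ 0) : 1 ≤ (z⁻¹).re ↔ Complex.normSq z ≤ z.re := by
  have hn : 0 < Complex.normSq z := Complex.normSq_pos.mpr hz
  rw [Complex.inv_re, le_div_iff₀ hn, one_mul]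

/-- In the closed upper half-disc (`|z|² ≤ Re z`, `Im z > 0`) one has `(Im z)² < Re z`, i.e. `V = Re z/(Im z)² > 1` is automatic off the boundary
point — walls only exist above `v = 0` (paper §1). -/
theorem im_sq_lt_re_of_mem_disc (z : ℂ) (hz : Complex.normSq z ≤ z.re) (hq : 0 < z.im) : z.im ^ 2 < z.re := by
  rw [Complex.normSq_apply] at hz
  nlinarith [sq_nonneg z.re, mul_pos hq hq]

/-- EXCLUDED DIRECTION (i).  If `z` is on the boundary arc (`|z|² = Re z`, `Im z ≥ 0`) and `w` is in the OPEN disc with `Im w > 0`, then on a common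
vertical `z` is strictly above `w`: `d = z − w` never points straight down while the comparison point is inside. -/
theorem twoPoint_not_below_of_mem_arc (z w : ℂ) (hz : Complex.normSq z = z.re) (hzi : 0 ≤ z.im)
    (hw : Complex.normSq w < w.re) (hwi : 0 < w.im) (hre : z.re = w.re) : w.im < z.im := by
  rw [Complex.normSq_apply] at hz hw
  by_contra hcon
  rw [not_lt] at hcon
  nlinarith [mul_le_mul hcon hcon hzi hwi.le]

/-- EXCLUDED DIRECTION (ii).  If `z` is in the CLOSED disc (`|z|² ≤ Re z`) and `w` with `Im w ≥ 0` is OUTSIDE it (`|w|² > Re w`), then on a common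
vertical `z` is strictly below `w`: `d = z − w` never points straight up after the comparison point has left the disc. -/
theorem twoPoint_not_above_of_not_mem_disc (z w : ℂ) (hz : Complex.normSq z ≤ z.re)
    (hw : w.re < Complex.normSq w) (hwi : 0 ≤ w.im) (hre : z.re = w.re) : z.im < w.im := by
  rw [Complex.normSq_apply] at hz hw
  by_contra hcon
  rw [not_lt] at hcon
  -- from `w.im ≤ z.im` and `0 ≤ w.im`: `w.im² ≤ z.im²`, contradicting `w.re² + w.im² > w.re = z.re ≥ z.re² + z.im²`
  nlinarith [mul_le_mul hcon hcon hwi (hwi.trans hcon)]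

/-- The comparison point `π(t) = (b t²/a, t/a)` is inside the open disc iff `t² < (ab − 1)/b²` — it enters at `t = 0⁺` and leaves exactly once, at
`t_exit = √(ab − 1)/b` (never inside when `V = ab ≤ 1`).  Typed as the algebraic equivalence for `a, b, t > 0`. -/
theorem twoPoint_mem_disc_iff (a b t : ℝ) (ha : 0 < a) (hb : 0 < b) (ht : 0 < t) :
    (b * t ^ 2 / a) ^ 2 + (t / a) ^ 2 < b * t ^ 2 / a ↔ b ^ 2 * t ^ 2 < a * b - 1 := by
  have ha0 : a ≠ 0 := ha.ne'
  have ht2 : 0 < t ^ 2 := by positivity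
  constructor
  · intro h
    have h' : (b ^ 2 * t ^ 2 + 1) * t ^ 2 / a ^ 2 < b * t ^ 2 / a := by
      have : (b * t ^ 2 / a) ^ 2 + (t / a) ^ 2 = (b ^ 2 * t ^ 2 + 1) * t ^ 2 / a ^ 2 := by field_simp
      linarith [this]
    rw [div_lt_div_iff₀ (by positivity) ha] at h'
    nlinarith [mul_pos ht2 ha]
  · intro h
    have h' : (b ^ 2 * t ^ 2 + 1) * t ^ 2 / a ^ 2 < b * t ^ 2 / a := by
      rw [div_lt_div_iff₀ (by positivity) ha]
      nlinarith [mul_pos ht2 ha]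
    have : (b * t ^ 2 / a) ^ 2 + (t / a) ^ 2 = (b ^ 2 * t ^ 2 + 1) * t ^ 2 / a ^ 2 := by field_simp
    linarith [this]

/-! ## 3. Engines of Theorem 7 of the note (prefixes `X(−1)(±2)`, `X ∈ {∅, (+2), (−2)}`)

For these prefixes `z = (1 + iσ)/(c + iσ)` with `σ = a₁/(t·R(x))`, `x = t²`, `R` the P-block ratio (`1`, `1 + a₀x`, `1 + a₀/x`) and `c = 1 + a₂x^{±1}`.
H-events (`Im z = t/a₋`) are the solutions of `Φ(x) = a₋a₁a₂`; V-strands are level crossings of `G = t²/Re z`.  The paper's Theorem 7 needs exactly: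
`Φ` injective for `(−1,−2)` and `(+2,−1,−2)` (≤ 1 H-event ⟹ W ≤ 0), `Φ` strictly convex for `(−2,−1,−2)` (≤ 2 H-events ⟹ W ≤ 1, attained), and `G`
increasing for the `+2` endings (no D-strand ⟹ W ≤ 0) — all typed below (`strictMonoOn_vcount` with `N_nil_monotoneOn` / `N_fastUp_monotoneOn`,
and `strictMonoOn_vcount'` with `M_fastDown_monotoneOn` for `X = −2`).  The topological half of Theorem 7 (continuous argument of `z − π`, IVT)
and the strand bookkeeping stay in the paper. -/

/-- Real part of the Möbius point `z = (1 + iσ)/(c + iσ)`, `c > 0`. -/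
theorem moebius_re (σ c : ℝ) (hc : 0 < c) :
    (((1 : ℂ) + I * σ) / ((c : ℂ) + I * σ)).re = (c + σ ^ 2) / (c ^ 2 + σ ^ 2) := by
  have hn : c ^ 2 + σ ^ 2 ≠ 0 := by positivity
  have hn' : c * c + σ * σ ≠ 0 := by nlinarith [hc, sq_nonneg σ]
  rw [Complex.div_re]
  simp [Complex.normSq_apply]
  field_simp

/-- Imaginary part of the Möbius point `z = (1 + iσ)/(c + iσ)`, `c > 0`. -/
theorem moebius_im (σ c : ℝ) (hc : 0 < c) :
    (((1 : ℂ) + I * σ) / ((c : ℂ) + I * σ)).im = σ * (c - 1) / (c ^ 2 + σ ^ 2) := by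
  have hn : c ^ 2 + σ ^ 2 ≠ 0 := by positivity
  have hn' : c * c + σ * σ ≠ 0 := by nlinarith [hc, sq_nonneg σ]
  rw [Complex.div_im]
  simp [Complex.normSq_apply]
  field_simp

/-- H-COUNT ENGINE, prefix `(−1,−2)`: `Φ(x) = (x + a₂)² + a₁²x` is strictly increasing on `x > 0` (so `Φ(x) = a₋a₁a₂` has at most one solution). -/
theorem phi_nil_strictMonoOn (a₁ a₂ : ℝ) (ha₂ : 0 < a₂) :
    StrictMonoOn (fun x : ℝ => (x + a₂) ^ 2 + a₁ ^ 2 * x) (Set.Ioi 0) := by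
  intro x hx y hy hxy
  simp only [Set.mem_Ioi] at hx hy
  have h1 : 0 < (y - x) * (y + x + 2 * a₂) := mul_pos (sub_pos.2 hxy) (by linarith)
  have h2 : 0 ≤ a₁ ^ 2 * (y - x) := mul_nonneg (sq_nonneg a₁) (sub_nonneg.2 hxy.le)
  nlinarith [h1, h2]

/-- H-COUNT ENGINE, prefix `(+2,−1,−2)`: `Φ(x) = (x + a₂)²(1 + a₀x) + a₁² x/(1 + a₀x)` is strictly increasing on `x > 0`. -/
theorem phi_fastUp_strictMonoOn (a₀ a₁ a₂ : ℝ) (ha₀ : 0 < a₀) (ha₂ : 0 < a₂) :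
    StrictMonoOn (fun x : ℝ => (x + a₂) ^ 2 * (1 + a₀ * x) + a₁ ^ 2 * (x / (1 + a₀ * x))) (Set.Ioi 0) := by
  intro x hx y hy hxy
  simp only [Set.mem_Ioi] at hx hy
  have hx1 : 0 < 1 + a₀ * x := by positivity
  have hy1 : 0 < 1 + a₀ * y := by positivity
  have hA : (x + a₂) ^ 2 * (1 + a₀ * x) < (y + a₂) ^ 2 * (1 + a₀ * y) := by
    have hsq : (x + a₂) ^ 2 < (y + a₂) ^ 2 := by nlinarith
    have hlin : 1 + a₀ * x ≤ 1 + a₀ * y := by nlinarith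
    calc (x + a₂) ^ 2 * (1 + a₀ * x) < (y + a₂) ^ 2 * (1 + a₀ * x) := by
            exact mul_lt_mul_of_pos_right hsq hx1
      _ ≤ (y + a₂) ^ 2 * (1 + a₀ * y) := by
            exact mul_le_mul_of_nonneg_left hlin (sq_nonneg _)
  have hB : x / (1 + a₀ * x) ≤ y / (1 + a₀ * y) := by
    rw [div_le_div_iff₀ hx1 hy1]
    nlinarith
  have hB' : a₁ ^ 2 * (x / (1 + a₀ * x)) ≤ a₁ ^ 2 * (y / (1 + a₀ * y)) := mul_le_mul_of_nonneg_left hB (sq_nonneg a₁)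
  show (x + a₂) ^ 2 * (1 + a₀ * x) + a₁ ^ 2 * (x / (1 + a₀ * x)) < (y + a₂) ^ 2 * (1 + a₀ * y) + a₁ ^ 2 * (y / (1 + a₀ * y))
  linarith

/-- H-COUNT ENGINE, prefix `(−2,−1,−2)`: the decomposed form of `Φ(x) = (x + a₂)²(1 + a₀/x) + a₁² x/(1 + a₀/x)`,
`x² + (2a₂ + a₀ + a₁²)x + (a₂² + 2a₀a₂ − a₁²a₀) + a₀a₂²/x + a₁²a₀²/(x + a₀)`, is STRICTLY CONVEX on `x > 0`
(so `Φ(x) = a₋a₁a₂` has at most two solutions: at most two H-events, W ≤ 1 — the family of g15's W = +1 record). -/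
theorem phi_fastDown_strictConvexOn (a₀ a₁ a₂ : ℝ) (ha₀ : 0 < a₀) (ha₂ : 0 < a₂) :
    StrictConvexOn ℝ (Set.Ioi 0) (fun x : ℝ =>
      x ^ 2 + ((2 * a₂ + a₀ + a₁ ^ 2) * x + (a₂ ^ 2 + 2 * a₀ * a₂ - a₁ ^ 2 * a₀))
        + (a₀ * a₂ ^ 2) * x ^ (-1 : ℤ) + (a₁ ^ 2 * a₀ ^ 2) * (a₀ + x) ^ (-1 : ℤ)) := by
  have hs : Convex ℝ (Set.Ioi (0 : ℝ)) := convex_Ioi 0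
  -- x²: strictly convex
  have h1 : StrictConvexOn ℝ (Set.Ioi 0) (fun x : ℝ => x ^ 2) :=
    (strictConvexOn_pow (le_refl 2)).subset Set.Ioi_subset_Ici_self hs
  -- affine part: convex
  have h2 : ConvexOn ℝ (Set.Ioi 0) (fun x : ℝ => (2 * a₂ + a₀ + a₁ ^ 2) * x + (a₂ ^ 2 + 2 * a₀ * a₂ - a₁ ^ 2 * a₀)) := by
    have hc : 0 ≤ 2 * a₂ + a₀ + a₁ ^ 2 := by positivity
    have := ((convexOn_id hs).smul hc).add (convexOn_const (a₂ ^ 2 + 2 * a₀ * a₂ - a₁ ^ 2 * a₀) hs)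
    refine this.congr ?_
    intro x _
    simp [smul_eq_mul]
  -- a₀a₂²/x: convex
  have h3 : ConvexOn ℝ (Set.Ioi 0) (fun x : ℝ => (a₀ * a₂ ^ 2) * x ^ (-1 : ℤ)) := by
    have hc : 0 ≤ a₀ * a₂ ^ 2 := by positivity
    have := (convexOn_zpow (-1 : ℤ) (𝕜 := ℝ)).smul hc
    refine this.congr ?_
    intro x _
    simp [smul_eq_mul]
  -- a₁²a₀²/(a₀ + x): convex (translate of x⁻¹)
  have h4 : ConvexOn ℝ (Set.Ioi 0) (fun x : ℝ => (a₁ ^ 2 * a₀ ^ 2) * (a₀ + x) ^ (-1 : ℤ)) := by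
    have hc : 0 ≤ a₁ ^ 2 * a₀ ^ 2 := by positivity
    have ht := (convexOn_zpow (-1 : ℤ) (𝕜 := ℝ)).translate_right a₀
    have hsub : Set.Ioi (0 : ℝ) ⊆ (fun z : ℝ => a₀ + z) ⁻¹' Set.Ioi 0 := by
      intro x hx
      simp only [Set.mem_preimage, Set.mem_Ioi] at hx ⊢
      linarith
    have := (ht.subset hsub hs).smul hc
    refine this.congr ?_
    intro x _
    simp [smul_eq_mul, Function.comp]
  exact ((h1.add_convexOn h2).add_convexOn h3).add_convexOn h4

/-- The decomposed form IS `Φ` for the prefix `(−2,−1,−2)` on `x > 0`. -/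
theorem phi_fastDown_eq (a₀ a₁ a₂ x : ℝ) (ha₀ : 0 < a₀) (hx : 0 < x) :
    (x + a₂) ^ 2 * (1 + a₀ / x) + a₁ ^ 2 * (x / (1 + a₀ / x))
      = x ^ 2 + ((2 * a₂ + a₀ + a₁ ^ 2) * x + (a₂ ^ 2 + 2 * a₀ * a₂ - a₁ ^ 2 * a₀))
        + (a₀ * a₂ ^ 2) * x ^ (-1 : ℤ) + (a₁ ^ 2 * a₀ ^ 2) * (a₀ + x) ^ (-1 : ℤ) := by
  have hx0 : x ≠ 0 := hx.ne'
  have hxa : a₀ + x ≠ 0 := by positivity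
  have hxa' : x + a₀ ≠ 0 := by positivity
  have h1x : 1 + a₀ / x ≠ 0 := by positivity
  simp only [zpow_neg_one]
  field_simp
  ring

/-- Consequence used in the paper: a strictly convex function on `x > 0` takes each value at most twice — a middle value lies strictly below
the max of the outer ones. -/
theorem lt_max_of_strictConvexOn {f : ℝ → ℝ} (hf : StrictConvexOn ℝ (Set.Ioi 0) f) {x y w : ℝ}
    (hx : 0 < x) (hxy : x < y) (hyw : y < w) : f y < max (f x) (f w) := by
  have hw : 0 < w := by linarith
  refine hf.lt_on_openSegment (Set.mem_Ioi.2 hx) (Set.mem_Ioi.2 hw) (by linarith : x ≠ w) ?_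
  rw [openSegment_eq_Ioo (by linarith : x < w)]
  exact ⟨hxy, hyw⟩

/-- V-COUNT ENGINE (abstract form): if `N` is positive and nondecreasing on `x > 0`, `a ≥ 0`, `e ≥ 0`, then `x ↦ x + a x² N(x)/(N(x) + e)` is strictly
increasing on `x > 0`.  (For the `+2` endings `G = t²/Re z` has exactly this form with `a = a₂`, `e = a₁²`, `N = x(1 + a₂x)R(x)²`: `vcount_form`.) -/
theorem strictMonoOn_vcount (a e : ℝ) (ha : 0 ≤ a) (he : 0 ≤ e) (N : ℝ → ℝ)
    (hNpos : ∀ x, 0 < x → 0 < N x) (hNmono : MonotoneOn N (Set.Ioi 0)) :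
    StrictMonoOn (fun x : ℝ => x + a * x ^ 2 * (N x / (N x + e))) (Set.Ioi 0) := by
  intro x hx y hy hxy
  simp only [Set.mem_Ioi] at hx hy
  have hNx := hNpos x hx
  have hNy := hNpos y hy
  have hNxy : N x ≤ N y := hNmono (Set.mem_Ioi.2 hx) (Set.mem_Ioi.2 hy) hxy.le
  have hr : N x / (N x + e) ≤ N y / (N y + e) := by
    rw [div_le_div_iff₀ (by positivity) (by positivity)]
    nlinarith
  have hr0 : 0 ≤ N x / (N x + e) := by positivity
  have hsq : x ^ 2 ≤ y ^ 2 := by nlinarith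
  have hprod : x ^ 2 * (N x / (N x + e)) ≤ y ^ 2 * (N y / (N y + e)) :=
    mul_le_mul hsq hr hr0 (sq_nonneg y)
  have hfin : a * (x ^ 2 * (N x / (N x + e))) ≤ a * (y ^ 2 * (N y / (N y + e))) := mul_le_mul_of_nonneg_left hprod ha
  show x + a * x ^ 2 * (N x / (N x + e)) < y + a * y ^ 2 * (N y / (N y + e))
  nlinarith [hfin]

/-- `G = x (c² + σ²)/(c + σ²)` (`= t²/Re z` by `moebius_re`) in the V-count form: with `c = 1 + a₂x`, `σ² = a₁²/(x R²)`, `N = x c R²`: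
`G = x + a₂ x² N/(N + a₁²)`. -/
theorem vcount_form (a₁ a₂ x R : ℝ) (hx : 0 < x) (hR : 0 < R) (ha₂ : 0 ≤ a₂) :
    x * ((1 + a₂ * x) ^ 2 + a₁ ^ 2 / (x * R ^ 2)) / ((1 + a₂ * x) + a₁ ^ 2 / (x * R ^ 2))
      = x + a₂ * x ^ 2 * ((x * (1 + a₂ * x) * R ^ 2) / (x * (1 + a₂ * x) * R ^ 2 + a₁ ^ 2)) := by
  have hx0 : x ≠ 0 := hx.ne'
  have hR0 : R ≠ 0 := hR.ne'
  have hc : 0 < 1 + a₂ * x := by positivity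
  have hden1 : (1 + a₂ * x) + a₁ ^ 2 / (x * R ^ 2) ≠ 0 := by positivity
  have hden2 : x * (1 + a₂ * x) * R ^ 2 + a₁ ^ 2 ≠ 0 := by positivity
  rw [div_eq_iff hden1]
  field_simp
  ring

/-- The `N` of prefix `(−1,+2)` (`R = 1`): `N = x(1 + a₂x)`, monotone on `x > 0`. -/
theorem N_nil_monotoneOn (a₂ : ℝ) (ha₂ : 0 ≤ a₂) : MonotoneOn (fun x : ℝ => x * (1 + a₂ * x) * (1:ℝ) ^ 2) (Set.Ioi 0) := by
  intro x hx y hy hxy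
  simp only [Set.mem_Ioi] at hx hy
  show x * (1 + a₂ * x) * 1 ^ 2 ≤ y * (1 + a₂ * y) * 1 ^ 2
  nlinarith [mul_nonneg ha₂ (mul_nonneg hx.le (sub_nonneg.2 hxy)), mul_nonneg ha₂ (mul_nonneg hy.le (sub_nonneg.2 hxy))]

/-- The `N` of prefix `(+2,−1,+2)` (`R = 1 + a₀x`): `N = x(1 + a₂x)(1 + a₀x)²`, monotone on `x > 0`. -/
theorem N_fastUp_monotoneOn (a₀ a₂ : ℝ) (ha₀ : 0 ≤ a₀) (ha₂ : 0 ≤ a₂) :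
    MonotoneOn (fun x : ℝ => x * (1 + a₂ * x) * (1 + a₀ * x) ^ 2) (Set.Ioi 0) := by
  intro x hx y hy hxy
  simp only [Set.mem_Ioi] at hx hy
  have h1 : x * (1 + a₂ * x) ≤ y * (1 + a₂ * y) := by
    nlinarith [mul_nonneg ha₂ (mul_nonneg hx.le (sub_nonneg.2 hxy)), mul_nonneg ha₂ (mul_nonneg hy.le (sub_nonneg.2 hxy))]
  have h2 : (1 + a₀ * x) ^ 2 ≤ (1 + a₀ * y) ^ 2 := by
    have : 1 + a₀ * x ≤ 1 + a₀ * y := by nlinarith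
    have h0 : 0 ≤ 1 + a₀ * x := by positivity
    exact pow_le_pow_left₀ h0 this 2
  show x * (1 + a₂ * x) * (1 + a₀ * x) ^ 2 ≤ y * (1 + a₂ * y) * (1 + a₀ * y) ^ 2
  exact mul_le_mul h1 h2 (sq_nonneg _) (by positivity)

/-- V-COUNT ENGINE, second abstract form (covers the prefix `(−2,−1,+2)`, where `N = M/x` with `M = (1 + a₂x)(x + a₀)²` monotone but `N` not):
if `M` is positive and nondecreasing on `x > 0`, `a ≥ 0`, `e ≥ 0`, then `x ↦ x + a·x² M(x)/(M(x) + e x)` is strictly increasing on `x > 0`. -/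
theorem strictMonoOn_vcount' (a e : ℝ) (ha : 0 ≤ a) (he : 0 ≤ e) (M : ℝ → ℝ)
    (hMpos : ∀ x, 0 < x → 0 < M x) (hMmono : MonotoneOn M (Set.Ioi 0)) :
    StrictMonoOn (fun x : ℝ => x + a * (x ^ 2 * M x / (M x + e * x))) (Set.Ioi 0) := by
  intro x hx y hy hxy
  simp only [Set.mem_Ioi] at hx hy
  have hMx := hMpos x hx
  have hMy := hMpos y hy
  have hMxy : M x ≤ M y := hMmono (Set.mem_Ioi.2 hx) (Set.mem_Ioi.2 hy) hxy.le
  have hr : x ^ 2 * M x / (M x + e * x) ≤ y ^ 2 * M y / (M y + e * y) := by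
    rw [div_le_div_iff₀ (by positivity) (by positivity)]
    -- x²Mx(My + e y) ≤ y²My(Mx + e x)  ⟸  MxMy(y² − x²) ≥ 0 and e·xy·(y My − x Mx) ≥ 0
    have h1 : 0 ≤ M x * M y * (y ^ 2 - x ^ 2) := by
      have : 0 ≤ y ^ 2 - x ^ 2 := by nlinarith
      positivity
    have h2 : 0 ≤ e * (x * y) * (y * M y - x * M x) := by
      have : 0 ≤ y * M y - x * M x := by nlinarith [mul_le_mul hxy.le hMxy hMx.le hy.le]
      positivity
    nlinarith [h1, h2]
  have hfin : a * (x ^ 2 * M x / (M x + e * x)) ≤ a * (y ^ 2 * M y / (M y + e * y)) := mul_le_mul_of_nonneg_left hr ha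
  show x + a * (x ^ 2 * M x / (M x + e * x)) < y + a * (y ^ 2 * M y / (M y + e * y))
  linarith

/-- Passage `N = M/x`: `x² N/(N + e) = x² M/(M + e x)` for `x > 0`. -/
theorem vcount_form' (M e x : ℝ) (hx : 0 < x) (hM : 0 < M) (he : 0 ≤ e) :
    x ^ 2 * ((M / x) / (M / x + e)) = x ^ 2 * M / (M + e * x) := by
  have hx0 : x ≠ 0 := hx.ne'
  have h1 : M / x + e ≠ 0 := by positivity
  have h2 : M + e * x ≠ 0 := by positivity
  field_simp

/-- For the prefix `(−2,−1,+2)` (`R = 1 + a₀/x`): `N = x(1 + a₂x)(1 + a₀/x)² = M/x` with `M = (1 + a₂x)(x + a₀)²`. -/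
theorem N_fastDown_eq (a₀ a₂ x : ℝ) (hx : 0 < x) :
    x * (1 + a₂ * x) * (1 + a₀ / x) ^ 2 = ((1 + a₂ * x) * (x + a₀) ^ 2) / x := by
  have hx0 : x ≠ 0 := hx.ne'
  field_simp

/-- `M = (1 + a₂x)(x + a₀)²` is monotone on `x > 0` (and positive), so `strictMonoOn_vcount'` applies: `G` is increasing for `(−2,−1,+2)` as well. -/
theorem M_fastDown_monotoneOn (a₀ a₂ : ℝ) (ha₀ : 0 ≤ a₀) (ha₂ : 0 ≤ a₂) :
    MonotoneOn (fun x : ℝ => (1 + a₂ * x) * (x + a₀) ^ 2) (Set.Ioi 0) := by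
  intro x hx y hy hxy
  simp only [Set.mem_Ioi] at hx hy
  have h1 : 1 + a₂ * x ≤ 1 + a₂ * y := by nlinarith
  have h2 : (x + a₀) ^ 2 ≤ (y + a₀) ^ 2 := by
    have h0 : 0 ≤ x + a₀ := by positivity
    exact pow_le_pow_left₀ h0 (by linarith) 2
  show (1 + a₂ * x) * (x + a₀) ^ 2 ≤ (1 + a₂ * y) * (y + a₀) ^ 2
  exact mul_le_mul h1 h2 (sq_nonneg _) (by positivity)

end Summit.ValiantsHypothesis.ValiantsHypothesis.Theorems.KPlusLogSqLaw.TwoPoint
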